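import Summits.CriticalPhenomena.PercolationContinuityZ3.Theorems.PercNearOneGluingNoHeavyLowerTailKnQuestion8CoefficientwiseContraction
import Summits.CriticalPhenomena.PercolationContinuityZ3.Theorems.PercNearOneGluingNoHeavyLowerTailKnQuestion8CoefficientwisePointEdgeIdentity
import HarnessLib

/-!
# The root-set kernel at a root edge: `NC(G/e) = Φ({x,p},{x,p})`, `NC(G) = Φ({x,p},{x}) + Φ({x},{x,p})`, and RCSET ⟹ NO-CORE — prim-lf-2 gen 58

Support file (`--supports stmt-CriticalPhenomena-4575`, closed), prover `prim-lf-2` (gen 58).  No definitions, no named facts, no sorries; standard axioms.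
Memo `prim-lf-2/CW-IGCEX-gen58.md` §8b; companions `…CoefficientwiseRootSetKernelTop.lean` (`rcset_top_row`), `…CoefficientwiseContraction.lean` (`noCore_of_rootContraction`).

ROOT-SET KERNEL of `(ends, E', y, f, g)`: for finsets of vertices `A, B`,
  `Φ_{E'}(A, B) = Σ_{s ⊆ E' : ¬(y ∈ R_A(s) ∧ y ∈ R_B(E'∖s))} (f R_A(s) − f R_B(E'∖s))·(g R_A(s) − g R_B(E'∖s))`,  `R_A(t) = {v | ∃ a ∈ A, v ∈ C_a(t)}`.
For a root edge `e ∈ E` with ends `{x, p}`, `p ≠ x`, and `E' = E.erase e`: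
* `Coefficientwise.contractSum_eq_kernel` — the doubly-open (contraction) sum of `noCore_of_rootContraction`'s hypothesis equals `Φ_{E'}({x,p},{x,p})`
  (`C_x(s + e) = C_x(s) ∪ C_p(s)` by `mem_openCluster_insert_edge_iff`);
* `Coefficientwise.noCore_eq_kernel_sum` — `NC_E(x,y)[f,g] = Φ_{E'}({x,p},{x}) + Φ_{E'}({x},{x,p})` (split the colourings by the colour of `e`);
* `Coefficientwise.noCore_of_rcset_pair` — hence, if for every multigraph, every root edge and every target the KERNEL inequality
  `Φ_{E'}({x,p},{x,p}) ≤ Φ_{E'}({x,p},{x}) + Φ_{E'}({x},{x,p})` holds (this is CONJECTURE RCSET of prim-lf-2 gen 58 for the nested pair `({x},{x,p})`, the two hybrid terms being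
  equal by the colour swap), then CONJECTURE NO-CORE holds on the types `ι, V` (via `noCore_of_rootContraction`).
[cite: KozmaNitzan2024, Questions 8–9 (§5.5 p. 36) (context: the Question-8 pocket covariance programme)]
-/

namespace Summit.CriticalPhenomena.PercolationContinuityZ3.Theorems

open Finset Literature.Probability.Percolation

namespace Coefficientwise

variable {ι V : Type*} [DecidableEq ι] [DecidableEq V]

/-- Adding the root edge `e = {x,p}`: `C_x(s + e) = C_x(s) ∪ C_p(s)`, written as the cluster of the set `{x,p}`. [cite: KozmaNitzan2024, §5.5 (context only; folklore)] -/
theorem openCluster_insert_rootEdge_eq_pairCluster (ends : ι → Sym2 V) {e : ι} {x p : V} (hxp : ends e = s(x, p)) (hpx : p ≠ x) (s : Finset ι) :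
    openCluster (ends '' (↑(insert e s) : Set ι)) x = {v | ∃ a ∈ ({x, p} : Finset V), v ∈ openCluster (ends '' (↑s : Set ι)) a} := by
  ext v
  rw [Set.mem_setOf_eq, mem_openCluster_insert_edge_iff ends x s hxp hpx.symm v]
  simp only [Finset.mem_insert, Finset.mem_singleton, exists_eq_or_imp, exists_eq_left, mem_openCluster_self, true_or, true_and]
  tauto

omit [DecidableEq ι] [DecidableEq V] in
/-- The cluster of the singleton root set `{x}` is `C_x`. [folklore] -/
theorem singletonCluster_eq (ends : ι → Sym2 V) (x : V) (s : Finset ι) :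
    {v | ∃ a ∈ ({x} : Finset V), v ∈ openCluster (ends '' (↑s : Set ι)) a} = openCluster (ends '' (↑s : Set ι)) x := by
  ext v; simp

/-- For `e ∈ E` and `s ⊆ E.erase e`: `E ∖ s = (E.erase e ∖ s) + e` (local copy of the lemma in `…CoefficientwiseRootRegrouping.lean`). [folklore] -/
private theorem sdiff_eq_insert_erase_sdiff' {E s : Finset ι} {e : ι} (he : e ∈ E) (hs : s ⊆ E.erase e) : E \ s = insert e (E.erase e \ s) := by
  ext i
  simp only [Finset.mem_sdiff, Finset.mem_insert, Finset.mem_erase]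
  constructor
  · rintro ⟨hiE, his⟩
    by_cases hie : i = e
    · exact Or.inl hie
    · exact Or.inr ⟨⟨hie, hiE⟩, his⟩
  · rintro (rfl | ⟨⟨_, hiE⟩, his⟩)
    · exact ⟨he, fun hes => (Finset.mem_erase.mp (hs hes)).1 rfl⟩
    · exact ⟨hiE, his⟩

open Classical in
/-- **`NC(G/e) = Φ({x,p},{x,p})`.**  The doubly-open sum over `s ⊆ E ∖ e` (hypothesis side of `noCore_of_rootContraction`) is the diagonal kernel entry of the root set `{x,p}`
for the edge set `E.erase e`. [cite: KozmaNitzan2024, Questions 8–9 (§5.5 p. 36) (context)] -/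
theorem contractSum_eq_kernel (ends : ι → Sym2 V) (E : Finset ι) {e : ι} (he : e ∈ E) {x p : V} (y : V) (hxp : ends e = s(x, p)) (hpx : p ≠ x)
    (f g : Set V → ℝ) :
    (∑ s ∈ (E.erase e).powerset.filter (fun s : Finset ι =>
          ¬ (y ∈ openCluster (ends '' (↑(insert e s) : Set ι)) x ∧ y ∈ openCluster (ends '' (↑(E \ s) : Set ι)) x)),
        (f (openCluster (ends '' (↑(insert e s) : Set ι)) x) - f (openCluster (ends '' (↑(E \ s) : Set ι)) x)) *
          (g (openCluster (ends '' (↑(insert e s) : Set ι)) x) - g (openCluster (ends '' (↑(E \ s) : Set ι)) x))) =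
    ∑ s ∈ (E.erase e).powerset.filter (fun s : Finset ι =>
          ¬ (y ∈ {v | ∃ a ∈ ({x, p} : Finset V), v ∈ openCluster (ends '' (↑s : Set ι)) a} ∧
             y ∈ {v | ∃ a ∈ ({x, p} : Finset V), v ∈ openCluster (ends '' (↑(E.erase e \ s) : Set ι)) a})),
        (f {v | ∃ a ∈ ({x, p} : Finset V), v ∈ openCluster (ends '' (↑s : Set ι)) a} -
            f {v | ∃ a ∈ ({x, p} : Finset V), v ∈ openCluster (ends '' (↑(E.erase e \ s) : Set ι)) a}) *
          (g {v | ∃ a ∈ ({x, p} : Finset V), v ∈ openCluster (ends '' (↑s : Set ι)) a} -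
            g {v | ∃ a ∈ ({x, p} : Finset V), v ∈ openCluster (ends '' (↑(E.erase e \ s) : Set ι)) a}) := by
  have hR : ∀ s : Finset ι, openCluster (ends '' (↑(insert e s) : Set ι)) x =
      {v | ∃ a ∈ ({x, p} : Finset V), v ∈ openCluster (ends '' (↑s : Set ι)) a} :=
    fun s => openCluster_insert_rootEdge_eq_pairCluster ends hxp hpx s
  have hB : ∀ s : Finset ι, s ⊆ E.erase e → openCluster (ends '' (↑(E \ s) : Set ι)) x =
      {v | ∃ a ∈ ({x, p} : Finset V), v ∈ openCluster (ends '' (↑(E.erase e \ s) : Set ι)) a} := by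
    intro s hs
    rw [sdiff_eq_insert_erase_sdiff' he hs]
    exact openCluster_insert_rootEdge_eq_pairCluster ends hxp hpx _
  have hfilter : (E.erase e).powerset.filter (fun s : Finset ι =>
          ¬ (y ∈ openCluster (ends '' (↑(insert e s) : Set ι)) x ∧ y ∈ openCluster (ends '' (↑(E \ s) : Set ι)) x)) =
      (E.erase e).powerset.filter (fun s : Finset ι =>
          ¬ (y ∈ {v | ∃ a ∈ ({x, p} : Finset V), v ∈ openCluster (ends '' (↑s : Set ι)) a} ∧
             y ∈ {v | ∃ a ∈ ({x, p} : Finset V), v ∈ openCluster (ends '' (↑(E.erase e \ s) : Set ι)) a})) := by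
    refine Finset.filter_congr fun s hs => ?_
    rw [hR s, hB s (Finset.mem_powerset.mp hs)]
  rw [hfilter]
  refine Finset.sum_congr rfl fun s hs => ?_
  rw [hR s, hB s (Finset.mem_powerset.mp (Finset.mem_filter.mp hs).1)]

open Classical in
/-- **`NC(G) = Φ({x,p},{x}) + Φ({x},{x,p})`** for a root edge `e = {x,p} ∈ E` (`E' = E.erase e`): split the colourings of `E` by the colour of `e`.
[cite: KozmaNitzan2024, Questions 8–9 (§5.5 p. 36) (context)] -/
theorem noCore_eq_kernel_sum (ends : ι → Sym2 V) (E : Finset ι) {e : ι} (he : e ∈ E) {x p : V} (y : V) (hxp : ends e = s(x, p)) (hpx : p ≠ x)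
    (f g : Set V → ℝ) :
    (∑ s ∈ E.powerset.filter (fun s : Finset ι => ¬ (y ∈ openCluster (ends '' (↑s : Set ι)) x ∧ y ∈ openCluster (ends '' (↑(E \ s) : Set ι)) x)),
        (f (openCluster (ends '' (↑s : Set ι)) x) - f (openCluster (ends '' (↑(E \ s) : Set ι)) x)) *
          (g (openCluster (ends '' (↑s : Set ι)) x) - g (openCluster (ends '' (↑(E \ s) : Set ι)) x))) =
    (∑ s ∈ (E.erase e).powerset.filter (fun s : Finset ι =>
          ¬ (y ∈ {v | ∃ a ∈ ({x, p} : Finset V), v ∈ openCluster (ends '' (↑s : Set ι)) a} ∧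
             y ∈ {v | ∃ a ∈ ({x} : Finset V), v ∈ openCluster (ends '' (↑(E.erase e \ s) : Set ι)) a})),
        (f {v | ∃ a ∈ ({x, p} : Finset V), v ∈ openCluster (ends '' (↑s : Set ι)) a} -
            f {v | ∃ a ∈ ({x} : Finset V), v ∈ openCluster (ends '' (↑(E.erase e \ s) : Set ι)) a}) *
          (g {v | ∃ a ∈ ({x, p} : Finset V), v ∈ openCluster (ends '' (↑s : Set ι)) a} -
            g {v | ∃ a ∈ ({x} : Finset V), v ∈ openCluster (ends '' (↑(E.erase e \ s) : Set ι)) a})) +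
    (∑ s ∈ (E.erase e).powerset.filter (fun s : Finset ι =>
          ¬ (y ∈ {v | ∃ a ∈ ({x} : Finset V), v ∈ openCluster (ends '' (↑s : Set ι)) a} ∧
             y ∈ {v | ∃ a ∈ ({x, p} : Finset V), v ∈ openCluster (ends '' (↑(E.erase e \ s) : Set ι)) a})),
        (f {v | ∃ a ∈ ({x} : Finset V), v ∈ openCluster (ends '' (↑s : Set ι)) a} -
            f {v | ∃ a ∈ ({x, p} : Finset V), v ∈ openCluster (ends '' (↑(E.erase e \ s) : Set ι)) a}) *
          (g {v | ∃ a ∈ ({x} : Finset V), v ∈ openCluster (ends '' (↑s : Set ι)) a} -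
            g {v | ∃ a ∈ ({x, p} : Finset V), v ∈ openCluster (ends '' (↑(E.erase e \ s) : Set ι)) a})) := by
  -- notation
  set E' : Finset ι := E.erase e with hE'
  set K : Finset ι → Set V := fun s => openCluster (ends '' (↑s : Set ι)) x with hK
  set RP : Finset ι → Set V := fun s => {v | ∃ a ∈ ({x, p} : Finset V), v ∈ openCluster (ends '' (↑s : Set ι)) a} with hRP
  set RX : Finset ι → Set V := fun s => {v | ∃ a ∈ ({x} : Finset V), v ∈ openCluster (ends '' (↑s : Set ι)) a} with hRX
  have hRX : ∀ s, RX s = K s := fun s => singletonCluster_eq ends x s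
  have heE' : e ∉ E' := fun h => (Finset.mem_erase.mp h).1 rfl
  have hEins : E = insert e E' := (Finset.insert_erase he).symm
  -- cluster identities for the two colours of `e`
  have red1 : ∀ t : Finset ι, K (insert e t) = RP t := fun t => openCluster_insert_rootEdge_eq_pairCluster ends hxp hpx t
  have blue1 : ∀ t : Finset ι, t ⊆ E' → K (E \ insert e t) = RX (E' \ t) := by
    intro t ht
    have : E \ insert e t = E' \ t := by
      ext i
      simp only [Finset.mem_sdiff, Finset.mem_insert, hE', Finset.mem_erase, not_or]
      tauto
    rw [this, hRX]
  have red2 : ∀ t : Finset ι, K t = RX t := fun t => (hRX t).symm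
  have blue2 : ∀ t : Finset ι, t ⊆ E' → K (E \ t) = RP (E' \ t) := by
    intro t ht
    rw [show E \ t = insert e (E' \ t) from sdiff_eq_insert_erase_sdiff' he ht]
    exact openCluster_insert_rootEdge_eq_pairCluster ends hxp hpx _
  -- write the NO-CORE sum as a sum over `E.powerset` of an indicator and split by `e`
  set T : Finset ι → ℝ := fun s => (f (K s) - f (K (E \ s))) * (g (K s) - g (K (E \ s))) with hT
  set P : Finset ι → Prop := fun s => ¬ (y ∈ K s ∧ y ∈ K (E \ s)) with hP
  change ∑ s ∈ E.powerset.filter P, T s = _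
  rw [Finset.sum_filter, hEins, Finset.sum_powerset_insert heE', ← hEins]
  rw [Finset.sum_filter, Finset.sum_filter, add_comm]
  congr 1
  · refine Finset.sum_congr rfl fun t ht => ?_
    have htE' := Finset.mem_powerset.mp ht
    simp only [hT, red1 t, blue1 t htE']
    rfl
  · refine Finset.sum_congr rfl fun t ht => ?_
    have htE' := Finset.mem_powerset.mp ht
    simp only [hT, red2 t, blue2 t htE']
    rfl

open Classical in
/-- **RCSET (for the pair `({x},{x,p})`) ⟹ CONJECTURE NO-CORE.**  If for every multigraph, every root edge `e = {x,p}` (`p ≠ x`), every target `y ∉ {x,p}` not joined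
to `x` by an edge of `E`, and all monotone `f, g`, the kernel inequality `Φ_{E∖e}({x,p},{x,p}) ≤ Φ_{E∖e}({x,p},{x}) + Φ_{E∖e}({x},{x,p})` holds, then the NO-CORE sum is
nonnegative for every `E`, root `x`, target `y ≠ x` and monotone `f, g`.  [cite: KozmaNitzan2024, Questions 8–9 (§5.5 p. 36) (context)] -/
theorem noCore_of_rcset_pair
    (hK : ∀ (ends : ι → Sym2 V) (E : Finset ι) (e : ι), e ∈ E → ∀ (x p y : V), ends e = s(x, p) → p ≠ x → y ≠ x → y ≠ p →
      (∀ i ∈ E, ends i ≠ s(x, y)) → ∀ (f g : Set V → ℝ), Monotone f → Monotone g →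
      (∑ s ∈ (E.erase e).powerset.filter (fun s : Finset ι =>
          ¬ (y ∈ {v | ∃ a ∈ ({x, p} : Finset V), v ∈ openCluster (ends '' (↑s : Set ι)) a} ∧
             y ∈ {v | ∃ a ∈ ({x, p} : Finset V), v ∈ openCluster (ends '' (↑(E.erase e \ s) : Set ι)) a})),
        (f {v | ∃ a ∈ ({x, p} : Finset V), v ∈ openCluster (ends '' (↑s : Set ι)) a} -
            f {v | ∃ a ∈ ({x, p} : Finset V), v ∈ openCluster (ends '' (↑(E.erase e \ s) : Set ι)) a}) *
          (g {v | ∃ a ∈ ({x, p} : Finset V), v ∈ openCluster (ends '' (↑s : Set ι)) a} -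
            g {v | ∃ a ∈ ({x, p} : Finset V), v ∈ openCluster (ends '' (↑(E.erase e \ s) : Set ι)) a})) ≤
      (∑ s ∈ (E.erase e).powerset.filter (fun s : Finset ι =>
          ¬ (y ∈ {v | ∃ a ∈ ({x, p} : Finset V), v ∈ openCluster (ends '' (↑s : Set ι)) a} ∧
             y ∈ {v | ∃ a ∈ ({x} : Finset V), v ∈ openCluster (ends '' (↑(E.erase e \ s) : Set ι)) a})),
        (f {v | ∃ a ∈ ({x, p} : Finset V), v ∈ openCluster (ends '' (↑s : Set ι)) a} -
            f {v | ∃ a ∈ ({x} : Finset V), v ∈ openCluster (ends '' (↑(E.erase e \ s) : Set ι)) a}) *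
          (g {v | ∃ a ∈ ({x, p} : Finset V), v ∈ openCluster (ends '' (↑s : Set ι)) a} -
            g {v | ∃ a ∈ ({x} : Finset V), v ∈ openCluster (ends '' (↑(E.erase e \ s) : Set ι)) a})) +
      (∑ s ∈ (E.erase e).powerset.filter (fun s : Finset ι =>
          ¬ (y ∈ {v | ∃ a ∈ ({x} : Finset V), v ∈ openCluster (ends '' (↑s : Set ι)) a} ∧
             y ∈ {v | ∃ a ∈ ({x, p} : Finset V), v ∈ openCluster (ends '' (↑(E.erase e \ s) : Set ι)) a})),
        (f {v | ∃ a ∈ ({x} : Finset V), v ∈ openCluster (ends '' (↑s : Set ι)) a} -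
            f {v | ∃ a ∈ ({x, p} : Finset V), v ∈ openCluster (ends '' (↑(E.erase e \ s) : Set ι)) a}) *
          (g {v | ∃ a ∈ ({x} : Finset V), v ∈ openCluster (ends '' (↑s : Set ι)) a} -
            g {v | ∃ a ∈ ({x, p} : Finset V), v ∈ openCluster (ends '' (↑(E.erase e \ s) : Set ι)) a})))
    (ends : ι → Sym2 V) (E : Finset ι) (x y : V) (hyx : y ≠ x) (f g : Set V → ℝ) (hf : Monotone f) (hg : Monotone g) :
    0 ≤ ∑ s ∈ E.powerset.filter (fun s : Finset ι => ¬ (y ∈ openCluster (ends '' (↑s : Set ι)) x ∧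
          y ∈ openCluster (ends '' (↑(E \ s) : Set ι)) x)),
      (f (openCluster (ends '' (↑s : Set ι)) x) - f (openCluster (ends '' (↑(E \ s) : Set ι)) x)) *
        (g (openCluster (ends '' (↑s : Set ι)) x) - g (openCluster (ends '' (↑(E \ s) : Set ι)) x)) := by
  refine noCore_of_rootContraction (fun ends' E' e he x' p' y' hxp hpx hyx' hyp hadj f' g' hf' hg' => ?_) ends E x y hyx f g hf hg
  rw [contractSum_eq_kernel ends' E' he y' hxp hpx f' g', noCore_eq_kernel_sum ends' E' he y' hxp hpx f' g']
  exact hK ends' E' e he x' p' y' hxp hpx hyx' hyp hadj f' g' hf' hg'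

end Coefficientwise

end Summit.CriticalPhenomena.PercolationContinuityZ3.Theorems
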